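import Literature.Computability.Cryptography.CubicClassPost
import Literature.Computability.Cryptography.CubicClassTableLadder
import Literature.Computability.Cryptography.CubicClassTableSpecs
import Literature.Computability.Cryptography.CubicClassTableProgramSpecs
import Literature.Computability.Cryptography.CubicClassStageSpecs
import Literature.Computability.Cryptography.PeriodFindingSums
import Mathlib.NumberTheory.NumberField.ClassNumber
import Mathlib.NumberTheory.NumberField.Units.Regulator
import Mathlib.GroupTheory.Index
import HarnessLib

/-!
# The class-group stage: the abstract shift-cell/coset table and the per-unit sampling law (definitions)

Topic `Computability/Cryptography`; DEFINITIONS ONLY (named `Prop`s), companion of `CubicClassTableLadder.lean`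
(`ClassTableInterfaceQE`), `CubicClassPost.lean` (the post-processor) and `CubicClassStageSpecs.lean` (the goal). They cut
the class-group stage of the crux `LinnikCubicClassGroups.PureCubicClassGroupFBQP` (line `arakelov-giant-step-cycle`) into
three parts that share NO number theory:

* `ShiftCellCosetTable` — the STRUCTURE of a table `F : ℕ → Ω` on positions `v = E + W j + W 2^ℓy κ'` (`W = M^T`,
  `M = 2^ℓe`): off a set of coin values of density `εκ` it ignores the coins; off a defect set of density `εD` it is the
  shift-cell table `C_{cls E}((σ E + j) mod 2^s)` whose classes are the cosets of a lattice `Λ ≤ ℤ^T` through the digit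
  vectors, with class-disjoint cell values, integer shifts within `1` of an exact-affine `y` (slope `−2^s μ`), run-shaped
  cells and at most `Ncell` cells per class. This is VERBATIM the conclusion of `ClassTableInterfaceQE`, made abstract in
  `T, Ω` and in the densities / cell count (number theory proves it: `ClassTableInterfaceQ3` below; harmonic analysis
  consumes it).
* `ClassTableInterfaceQ3` — `ClassTableInterfaceQE` restated through `ShiftCellCosetTable`, with the corrected cell count
  `2^(npp+5) (27a²b²)^6` (every class carries `≤ 2^npp R_K + 3·(6 R_K / log 2 + 1) ≤ 2^(npp+5) |d_K|^6` cell values; the earlier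
  `2^(npp+2)(27a²b²)^6 + 2^10` fails for `npp ≤ 1`) and the subgroup written with the conjunct order used by the line's skeleton.
* `distZ`, `dualReps`, `Acc`, `AccAll`, `PostParams.Lq`, **`UnitSamplingLaw`** — the PER-UNIT LAW the harmonic analysis
  delivers and the post-processing consumes: a weight `w₁ ≥ 0` on the characters `c < Q = 2^Lq` of one Fourier-sampling unit
  such that (a) all but `ε₁` of the mass sits on ACCURATE outcomes — `c` decodes (`CubicClassPost.PostParams.decodeUnit`) to a
  signed circle frequency `kk` and digit angles `φ_t` within `δ` (mod 1) of `ξ_t + kk μ'_t` for a character `ξ ∈ Λ^*/ℤ^T`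
  and ONE coupling vector `μ'` — and (b) given `kk`, the character `ξ` is pointwise `(1+ε₂)`-near-uniform on `Λ^*/ℤ^T`.
  The true law `w` of a unit may differ from `w₁` by a small total variation (coins, defects), handled by the consumer.
* `PostParams.postOutC` — the post-processor CAPPED at the denominator bound (`0` unless the common denominator of the
  derived rows is `≤ B`; on accurate outcomes it is, since it divides the exponent of `Λ^*/ℤ^T`), which — unlike the uncapped
  `postOutR`, whose `lcm` of garbage denominators can be exponentially long — is a polynomial-time function.
* `TableArgs`, `tableArgsE`, `instOfArgs`, `PostArgs`, `postArgsE` — the argument tuples of the two programs and their codes;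
  `ClaimLexMin`, `ClaimTableFP`, `ClaimTableSem`, `ClaimSamplingLaw`, `ClaimPost` — the five statements of the parts of the
  class-group stage, NAMED (so that the registered stub texts and the assembly `ClaimLexMin → ClaimTableFP → ClaimTableSem →
  ClaimSamplingLaw → ClaimPost → ClassStageGoal` stay short). They assert nothing by themselves.
[Hallgren 2005, §4; Kitaev 1995, §4]

## References

* S. Hallgren, STOC 2005, §4. [Hallgren2005]
* A. Yu. Kitaev, arXiv:quant-ph/9511026 (1995), §4. [Kitaev1995]
* J. Buchmann, H. C. Williams, Math. Comp. 50 (1988), §3. [BuchmannWilliams1988]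
-/

noncomputable section

open scoped Classical

namespace Literature.Computability.Cryptography

open Finset
open scoped NumberField nonZeroDivisors

namespace CubicClassSampling

/-! ### The abstract shift-cell / coset table -/

/-- **A shift-cell table with coset structure** (the abstract form of the class-group table's structural interface):
`T` digits of `ℓe` bits (`W = (2^ℓe)^T`), grid `2^s ∣ 2^ℓy`, coin block `ℓκ`, table `F`; hidden lattice `Λ`; coin-free
table `F₀`; classes `cls`, integer shifts `σ`, cells `C`, exact-affine shifts `y` with slope `μ`; bad coins `Badκ`
(density `εκ`), defects `D` (density `εD`); at most `Ncell` cell values per class, each fibre at most two runs.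
[cite: Hallgren2005, §4] -/
def ShiftCellCosetTable (T ℓe s ℓy ℓκ Ncell : ℕ) {Ω : Type*} [DecidableEq Ω] (F : ℕ → Ω) (Λ : AddSubgroup (Fin T → ℤ))
    (F₀ : ℕ → Ω) (cls σ : ℕ → ℕ) (C : ℕ → ℕ → Ω) (y : ℕ → ℝ) (μ : Fin T → ℝ) (Badκ D : Finset ℕ)
    (εκ εD : ℝ) : Prop :=
  -- (ii) coins: off a small bad set the table does not depend on the coin block (nor on the padding above it)
  ((Badκ.card : ℝ) ≤ εκ * 2 ^ ℓκ) ∧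
  (∀ v : ℕ, (v / ((2 ^ ℓe) ^ T * 2 ^ ℓy)) % 2 ^ ℓκ ∉ Badκ → F v = F₀ (v % ((2 ^ ℓe) ^ T * 2 ^ ℓy))) ∧
  -- (iii) the shift-cell idealisation off a small defect set
  ((D.card : ℝ) ≤ εD * ((2 ^ ℓe) ^ T * 2 ^ ℓy : ℕ)) ∧
  (∀ E < (2 ^ ℓe) ^ T, ∀ j < 2 ^ ℓy, E + (2 ^ ℓe) ^ T * j ∉ D →
    F₀ (E + (2 ^ ℓe) ^ T * j) = C (cls E) ((σ E + j) % 2 ^ s)) ∧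
  -- (iv) classes = cosets of Λ (through the digit vectors); cell values of distinct classes are distinct
  (∀ E < (2 ^ ℓe) ^ T, ∀ E' < (2 ^ ℓe) ^ T, cls E = cls E' ↔
    (fun t : Fin T => ((E / (2 ^ ℓe) ^ (t : ℕ) % 2 ^ ℓe : ℕ) : ℤ) -
      ((E' / (2 ^ ℓe) ^ (t : ℕ) % 2 ^ ℓe : ℕ) : ℤ)) ∈ Λ) ∧
  (∀ E < (2 ^ ℓe) ^ T, ∀ E' < (2 ^ ℓe) ^ T, ∀ i < 2 ^ s, ∀ i' < 2 ^ s,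
    C (cls E) i = C (cls E') i' → cls E = cls E') ∧
  -- (v) the shifts are exact-affine along the classes up to rounding
  (∀ E < (2 ^ ℓe) ^ T, |(σ E : ℝ) - y E| ≤ 1) ∧
  (∀ E < (2 ^ ℓe) ^ T, ∀ E' < (2 ^ ℓe) ^ T, cls E = cls E' →
    ∃ z : ℤ, y E' - y E + 2 ^ s * ∑ t : Fin T, μ t *
      (((E' / (2 ^ ℓe) ^ (t : ℕ) % 2 ^ ℓe : ℕ) : ℝ) - ((E / (2 ^ ℓe) ^ (t : ℕ) % 2 ^ ℓe : ℕ) : ℝ)) = 2 ^ s * z) ∧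
  -- (vi) cells: fibres are at most two intervals; few cells per class
  (∀ E < (2 ^ ℓe) ^ T,
    (∀ ω ∈ (Finset.range (2 ^ s)).image (C (cls E)), ∃ b₁ b₂ b₁' b₂' : ℕ,
      Disjoint (Finset.Ico b₁ b₂) (Finset.Ico b₁' b₂') ∧
      (Finset.range (2 ^ s)).filter (fun i => C (cls E) i = ω) = Finset.Ico b₁ b₂ ∪ Finset.Ico b₁' b₂') ∧
    ((Finset.range (2 ^ s)).image (C (cls E))).card ≤ Ncell)

/-- **The structural interface of the ladder-walk class table, final form**: as `ClassTableInterfaceQE` but with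
(i) the coins per prime `ℓb = 24 (size cap + 2) (50 + e + size |ps|)` (the union bound over the primes must still give
density `2^-(40+e)`: with the earlier `50 + e` it only gives `|ps|·2^-(49+e)`), (ii) more final baby steps `Bb ≥ 32 KN²` and
ladder levels `Tdbl ≥ 6 LD + 16` (slack for the residual after the greedy descent), (iii) NO absolute cap on `|ps|` (the
stage must succeed on every input): the exponent-weighted rounding budget of `b_E` and the `R̂`-versus-`R` drift over
`≤ T·2^ℓe` wraps are paid by `2·size |ps|` more bits of advice precision `k`, concluding `ShiftCellCosetTable` for
`classTableOpQ` with `T = 3|ps|`, cell count `2^(npp+5) (27a²b²)^6`, densities `2^-(40+e)`, `2^-(30+e)`, and the hidden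
lattice of index the order of the subgroup of `Cl(𝓞_K)` generated by the degree-one primes above `ps`.
[cite: Hallgren2005, §4] -/
def ClassTableInterfaceQ3 (F : CubicClassTable.WalkFns) (a b : ℕ) (K : Type*) [Field K] [NumberField K]
    (ord : ℕ × List ℤ) : Prop :=
  ∀ (m : ℕ) (ps : List ℕ) (r k : ℕ), (∀ p ∈ ps, p.Prime ∧ ¬ p ∣ 3 * m) → m = a * b ^ 2 →
      |(r : ℝ) - 2 ^ k * NumberField.Units.regulator K| ≤ 1 →
      ∀ (ℓe npp ℓy ℓκ ℓb prec s s₀ Tdbl Bfin Bb margin cap e : ℕ),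
        20 ≤ ℓe →
        ℓe + s + npp + 60 + 6 * Nat.size (27 * a ^ 2 * b ^ 2) + e + 2 * Nat.size ps.length ≤ k → k + s + npp + 64 ≤ prec →
        npp + 6 * Nat.size (27 * a ^ 2 * b ^ 2) + 50 + e ≤ s → s ≤ ℓy →
        s₀ = 18 * (10 * Nat.size (a * b) + 48) → 6 * Nat.size (27 * a ^ 2 * b ^ 2) + 16 ≤ Tdbl → margin = 0 →
        32 * (10 * Nat.size (a * b) + 48) ^ 2 ≤ Bb →
        (243 * a ^ 2 * b ^ 2) ^ 2 ≤ cap → (∀ p ∈ ps, (243 * a ^ 2 * b ^ 2 * (p + 1)) ^ 2 ≤ cap) →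
        ℓb = 24 * (Nat.size cap + 2) * (50 + e + Nat.size ps.length) → ps.length * ℓb ≤ ℓκ →
        ∃ (Λ : AddSubgroup (Fin (3 * ps.length) → ℤ)) (_ : Λ.FiniteIndex)
          (F₀ : ℕ → (ℕ × List ℤ) × ℕ) (cls σ : ℕ → ℕ) (C : ℕ → ℕ → (ℕ × List ℤ) × ℕ) (y : ℕ → ℝ)
          (μ : Fin (3 * ps.length) → ℝ) (Badκ D : Finset ℕ),
          Λ.index = Nat.card (Subgroup.closure {c : ClassGroup (𝓞 K) | ∃ p ∈ ps, ∃ P : Ideal (𝓞 K),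
            ∃ hP : P ∈ nonZeroDivisors (Ideal (𝓞 K)), P.IsPrime ∧ Ideal.absNorm P = p ∧ c = ClassGroup.mk0 ⟨P, hP⟩}) ∧
          ShiftCellCosetTable (3 * ps.length) ℓe s ℓy ℓκ (2 ^ (npp + 5) * (27 * a ^ 2 * b ^ 2) ^ 6)
            (F.classTableOpQ ⟨a, b, m, ps, ord, r, k, prec, s, ℓe, npp, ℓy, ℓκ, ℓb, s₀, Tdbl, Bfin, Bb, margin⟩ cap)
            Λ F₀ cls σ C y μ Badκ D ((1 / 2) ^ (40 + e)) ((1 / 2) ^ (30 + e))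

/-! ### The per-unit sampling law -/

/-- Distance to the nearest integer. [folklore] -/
def distZ (x : ℝ) : ℝ := |x - round x|

/-- **Representatives of the dual group `Λ^*/ℤ^T`** in `[0,1)^T ∩ ℚ^T`: rational vectors pairing integrally with `Λ`.
[cite: Kitaev1995, §4] -/
def dualReps (T : ℕ) (Λ : AddSubgroup (Fin T → ℤ)) : Set (Fin T → ℚ) :=
  {ξ | (∀ t, 0 ≤ ξ t ∧ ξ t < 1) ∧ ∀ v ∈ Λ, ∃ z : ℤ, ∑ t, ξ t * (v t : ℚ) = z}

/-- The block-length exponent of the unit: `Q = 2^Lq`, `Lq = top + aexp + s + ℓe·T` (coins and padding, slice multiplier,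
grid, digits — see `PostParams.decodeUnit`). [folklore] -/
def _root_.Literature.Computability.Cryptography.CubicClassPost.PostParams.Lq (P : CubicClassPost.PostParams) : ℕ :=
  P.top + P.aexp + P.s + P.ℓe * P.T

/-- **Accurate outcomes for `(kk, ξ)`**: `c` decodes with signed residue `kk` and a digit frequency whose angles
`φ_t` (`PostParams.phi`) are within `δ` (mod 1) of `ξ_t + kk μ'_t`. [cite: Hallgren2005, §4] -/
def Acc (P : CubicClassPost.PostParams) (μ' : Fin P.T → ℝ) (δ : ℝ) (kk : ℤ) (ξ : Fin P.T → ℚ) : Set ℕ :=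
  {c | ∃ ν : ℕ, P.decodeUnit c = some (kk, ν) ∧
    ∀ t : Fin P.T, distZ ((P.phi ν (t : ℕ) : ℝ) - (kk : ℝ) * μ' t - (ξ t : ℝ)) ≤ δ}

/-- All accurate outcomes (some residue, some character of `Λ^*/ℤ^T`). [folklore] -/
def AccAll (P : CubicClassPost.PostParams) (Λ : AddSubgroup (Fin P.T → ℤ)) (μ' : Fin P.T → ℝ) (δ : ℝ) : Set ℕ :=
  {c | ∃ (kk : ℤ) (ξ : Fin P.T → ℚ), ξ ∈ dualReps P.T Λ ∧ c ∈ Acc P μ' δ kk ξ}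

/-- **The per-unit sampling law** delivered by the harmonic analysis of the class table and consumed by the
post-processing: `w₁ ≥ 0` on the characters `c < 2^Lq`; (a) the inaccurate characters carry mass `≤ ε₁`; (b) for every
residue `kk` and every character `ξ` of `Λ^*/ℤ^T`, the mass of the outcomes accurate for `(kk, ξ)` is at most `(1+ε₂)/[ℤ^T:Λ]`
times the mass of all outcomes accurate for `kk`. [cite: Hallgren2005, §4; Kitaev1995, §4] -/
def UnitSamplingLaw (P : CubicClassPost.PostParams) (Λ : AddSubgroup (Fin P.T → ℤ)) (μ' : Fin P.T → ℝ)
    (δ ε₁ ε₂ : ℝ) (w₁ : ℕ → ℝ) : Prop :=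
  (∀ c, 0 ≤ w₁ c) ∧
  (∑ c ∈ (Finset.range (2 ^ P.Lq)).filter (fun c => c ∉ AccAll P Λ μ' δ), w₁ c) ≤ ε₁ ∧
  ∀ (kk : ℤ) (ξ : Fin P.T → ℚ), ξ ∈ dualReps P.T Λ →
    (∑ c ∈ (Finset.range (2 ^ P.Lq)).filter (fun c => c ∈ Acc P μ' δ kk ξ), w₁ c) ≤
      (1 + ε₂) / (Λ.index : ℝ) *
        ∑ c ∈ (Finset.range (2 ^ P.Lq)).filter (fun c => ∃ ξ' ∈ dualReps P.T Λ, c ∈ Acc P μ' δ kk ξ'), w₁ c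

/-! ### The capped post-processor and the program argument tuples -/

/-- **The capped post-processor**: the subgroup order of the derived rows when their common denominator is at most the
bound `B` (it divides the exponent of `Λ^*/ℤ^T ≤ [ℤ^T : Λ] ≤ B` on accurate outcomes), else `0`. [cite: Hallgren2005, §4] -/
def _root_.Literature.Computability.Cryptography.CubicClassPost.PostParams.postOutC
    (P : CubicClassPost.PostParams) (cs : List ℕ) : ℕ :=
  if CubicClassPost.lcmDen (P.pairRowsR cs) ≤ P.B then P.postOutR cs else 0

open Literature.Computability.Complexity (CodeFP uniformProb)
open Literature.Computability.Complexity.CodeFP (pairE strE natE intE unE rawE)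
open Literature.NumberTheory.CubicFields (PureCubicCodes.Mem PureCubicCodes.Canon)
open CubicClassTable (LexMinSpec LogSpec InvSpec ScaleSpec ProdSpec RedLEq PrimeSem RootsSem)
open PeriodFinding (corrMass)

/-- The argument tuple of the class-table program: the instance fields in the order of `CubicClassTable.Inst`
(`a b m ps ord r k prec s ℓe npp ℓy ℓκ ℓb s₀ Tdbl Bfin Bb margin`), then the clamp cap and the position. [folklore] -/
abbrev TableArgs : Type :=
  (ℕ × ℕ × ℕ × List ℕ × (ℕ × List ℤ) × ℕ × ℕ × ℕ × ℕ × ℕ × ℕ × ℕ × ℕ × ℕ × ℕ × ℕ × ℕ × ℕ × ℕ) × ℕ × ℕ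

/-- The code of the argument tuple (`a b m` binary, `ps` raw list, `ord` lattice code, `r` binary, the twelve small layout /
walk parameters `k prec s ℓe npp ℓy ℓκ ℓb s₀ Tdbl Bfin Bb` UNARY, `margin`, `cap`, `v` binary). [folklore] -/
def tableArgsE : TableArgs → List Bool :=
  pairE (pairE natE (pairE natE (pairE natE (pairE (rawE natE) (pairE (pairE natE (rawE intE)) (pairE natE (pairE unE
    (pairE unE (pairE unE (pairE unE (pairE unE (pairE unE (pairE unE (pairE unE (pairE unE (pairE unE (pairE unE
    (pairE unE natE)))))))))))))))))) (pairE natE natE)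

/-- The instance named by an argument tuple. [folklore] -/
def instOfArgs (q : TableArgs) : CubicClassTable.Inst :=
  ⟨q.1.1, q.1.2.1, q.1.2.2.1, q.1.2.2.2.1, q.1.2.2.2.2.1, q.1.2.2.2.2.2.1, q.1.2.2.2.2.2.2.1, q.1.2.2.2.2.2.2.2.1,
    q.1.2.2.2.2.2.2.2.2.1, q.1.2.2.2.2.2.2.2.2.2.1, q.1.2.2.2.2.2.2.2.2.2.2.1, q.1.2.2.2.2.2.2.2.2.2.2.2.1,
    q.1.2.2.2.2.2.2.2.2.2.2.2.2.1, q.1.2.2.2.2.2.2.2.2.2.2.2.2.2.1, q.1.2.2.2.2.2.2.2.2.2.2.2.2.2.2.1,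
    q.1.2.2.2.2.2.2.2.2.2.2.2.2.2.2.2.1, q.1.2.2.2.2.2.2.2.2.2.2.2.2.2.2.2.2.1, q.1.2.2.2.2.2.2.2.2.2.2.2.2.2.2.2.2.2.1,
    q.1.2.2.2.2.2.2.2.2.2.2.2.2.2.2.2.2.2.2⟩

/-- The argument tuple of the post-processor: `T ℓe s aexp top` (unary), `K₀ B` (binary), the outcome list. [folklore] -/
abbrev PostArgs : Type := (ℕ × ℕ × ℕ × ℕ × ℕ × ℕ × ℕ) × List ℕ

/-- The code of the post-processor's argument tuple. [folklore] -/
def postArgsE : PostArgs → List Bool :=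
  pairE (pairE unE (pairE unE (pairE unE (pairE unE (pairE unE (pairE natE natE)))))) (rawE natE)

/-- The post-processor parameters named by an argument tuple. [folklore] -/
def postOfArgs (q : PostArgs) : CubicClassPost.PostParams :=
  ⟨q.1.1, q.1.2.1, q.1.2.2.1, q.1.2.2.2.1, q.1.2.2.2.2.1, q.1.2.2.2.2.2.1, q.1.2.2.2.2.2.2⟩

/-! ### The five statements of the parts of the class-group stage, named -/

/-- **G2 (cylinder minimum program)**: a polynomial-time `lexE` meeting `LexMinSpec` in every pure cubic field.
[cite: BuchmannWilliams1988, §3] -/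
def ClaimLexMin : Prop :=
  ∃ lexE : (ℕ × ℕ) × (ℕ × List ℤ) → ℤ × ℤ × ℤ × ℕ,
    CodeFP (pairE (pairE natE natE) (pairE natE (rawE intE))) (pairE intE (pairE intE (pairE intE natE))) lexE ∧
    ∀ (a b : ℕ), Squarefree (a * b) → a * b ≠ 1 →
      ∀ (K : Type) [Field K] [NumberField K], Module.finrank ℚ K = 3 →
        ∀ θ : K, θ ^ 3 = ((a * b ^ 2 : ℕ) : K) →
        ∀ (σ₁ : K →+* ℝ) (σ₂ : K →+* ℂ), (∃ z : K, starRingEnd ℂ (σ₂ z) ≠ σ₂ z) →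
          LexMinSpec a b K θ σ₁ σ₂ lexE

/-- **P5a (the table and the post-processor are polynomial time)**: given polynomial-time programs for the cube roots, the
degree-one prime codes, the lattice product and the reduction step, with six-entry lattice outputs, the ladder class table
`classTableOpQ` is polynomial time in its argument tuple; and the capped post-processor is polynomial time.
[cite: Hallgren2005, §4] -/
def ClaimTableFP : Prop :=
  (∀ Fw : CubicClassTable.WalkFns,
    CodeFP (pairE natE (pairE natE strE)) (rawE natE) Fw.roots →
    CodeFP (pairE (pairE natE natE) (pairE (pairE natE (rawE intE)) (pairE natE natE))) (pairE natE (rawE intE)) Fw.primeL →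
    CodeFP (pairE (pairE natE natE) (pairE (pairE natE (rawE intE)) (pairE natE (rawE intE)))) (pairE natE (rawE intE))
      Fw.latProd →
    CodeFP (pairE (pairE (pairE natE natE) unE) (pairE natE (rawE intE))) (pairE (pairE natE (rawE intE)) intE) Fw.redL →
    (∀ x, (Fw.latProd x).2.length ≤ 6) → (∀ x, ((Fw.redL x).1).2.length ≤ 6) →
    CodeFP tableArgsE (pairE (pairE natE (rawE intE)) natE)
      (fun q : TableArgs => Fw.classTableOpQ (instOfArgs q) q.2.1 q.2.2)) ∧
  CodeFP postArgsE natE (fun q : PostArgs => (postOfArgs q).postOutC q.2)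

/-- **P5b (semantics of the table)**: for the pure cubic field `K = ℚ(θ)`, `θ³ = ab²`, programs meeting the reduction-step
specifications (`LexMinSpec`, `LogSpec`, `InvSpec`, `ScaleSpec`, `RedLEq`), the lattice product (`ProdSpec`), the degree-one
prime codes (`PrimeSem`) and the cube roots from coins (`RootsSem`), over the canonical code `ord` of `𝓞_K`, the ladder class
table has the structural interface `ClassTableInterfaceQ3`. [cite: Hallgren2005, §4; BuchmannWilliams1988, §3] -/
def ClaimTableSem : Prop :=
  ∀ (Fw : CubicClassTable.WalkFns) (lexE : (ℕ × ℕ) × (ℕ × List ℤ) → ℤ × ℤ × ℤ × ℕ)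
    (logE : (ℕ × ℕ) × ((ℤ × ℤ × ℤ × ℕ) × ℕ) → ℤ) (invE : (ℕ × ℕ) × (ℤ × ℤ × ℤ × ℕ) → ℤ × ℤ × ℤ × ℕ)
    (latScale : (ℕ × ℕ) × ((ℕ × List ℤ) × (ℤ × ℤ × ℤ × ℕ)) → ℕ × List ℤ)
    (a b : ℕ), Squarefree (a * b) → a * b ≠ 1 →
    ∀ (K : Type) [Field K] [NumberField K], Module.finrank ℚ K = 3 → ∀ θ : K, θ ^ 3 = ((a * b ^ 2 : ℕ) : K) →
    ∀ (σ₁ : K →+* ℝ) (σ₂ : K →+* ℂ), (∃ z : K, starRingEnd ℂ (σ₂ z) ≠ σ₂ z) →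
    ∀ ord : ℕ × List ℤ, PureCubicCodes.Canon ord → (∀ φ : K, PureCubicCodes.Mem θ b ord φ ↔ IsIntegral ℤ φ) →
    LexMinSpec a b K θ σ₁ σ₂ lexE → LogSpec a b logE → InvSpec a b K θ invE → ScaleSpec a b K θ latScale →
    RedLEq a b K θ lexE logE invE latScale Fw.redL → ProdSpec a b K θ Fw.latProd →
    PrimeSem Fw a b K θ ord → RootsSem Fw →
    ClassTableInterfaceQ3 Fw a b K ord

/-- **P6 (the per-unit sampling law of a shift-cell/coset table)**: Fourier sampling over `ℤ_Q`, `Q = 2^(top+(ℓy−s)+s+ℓe·T)`,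
of a table with the structure `ShiftCellCosetTable` yields a unit law within `2^-e₆` (total variation) of a weight `w₁`
satisfying `UnitSamplingLaw` with accuracy `δ = 2u/2^ℓe`, inaccurate mass `≤ 2^-e₆` and near-uniformity `1/8`, for
parameters beyond explicit thresholds (window `u ≥ 2^(e₆+8) hB (T+1)`, digit size `2^ℓe ≥ hB³ (2u)^T 2^(s+e₆+40)`, grid
`2^s ≥ Ncell·hB·2^(2e₆+16)` for the tail of the circle frequency beyond the slice window `K₀ ≈ 2^s/(2^(e₆+8) hB)`).
[cite: Hallgren2005, §4; Kitaev1995, §4] -/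
def ClaimSamplingLaw : Prop :=
  ∀ (T ℓe s ℓy ℓκ top Ncell hB u e₆ K₀ : ℕ) (Ω : Type) [DecidableEq Ω] (F : ℕ → Ω)
    (Λ : AddSubgroup (Fin T → ℤ)) [Λ.FiniteIndex] (F₀ : ℕ → Ω) (cls σ : ℕ → ℕ) (C : ℕ → ℕ → Ω)
    (y : ℕ → ℝ) (μ : Fin T → ℝ) (Badκ D : Finset ℕ) (εκ εD : ℝ),
    ShiftCellCosetTable T ℓe s ℓy ℓκ Ncell F Λ F₀ cls σ C y μ Badκ D εκ εD →
    1 ≤ T → s ≤ ℓy → ℓκ ≤ top → Λ.index ≤ hB → 1 ≤ hB →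
    0 ≤ εκ → 0 ≤ εD → εκ + εD ≤ (1 / 2) ^ (2 * e₆ + 8) →
    2 ^ (e₆ + 8) * hB * (T + 1) ≤ u →
    hB ^ 3 * (2 * u) ^ T * 2 ^ (s + e₆ + 40) ≤ 2 ^ ℓe →
    Ncell * hB * 2 ^ (2 * e₆ + 16) ≤ 2 ^ s →
    K₀ * (2 ^ (e₆ + 8) * hB) ≤ 2 ^ s → 2 ^ s ≤ 2 * K₀ * (2 ^ (e₆ + 8) * hB) →
    ∃ (μ' : Fin T → ℝ) (w₁ : ℕ → ℝ),
      (∑ c ∈ Finset.range (2 ^ (top + (ℓy - s) + s + ℓe * T)),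
        |corrMass (2 ^ (top + (ℓy - s) + s + ℓe * T)) F c / ((2 : ℝ) ^ (top + (ℓy - s) + s + ℓe * T)) ^ 2 - w₁ c|)
          ≤ (1 / 2) ^ e₆ ∧
      UnitSamplingLaw ⟨T, ℓe, s, ℓy - s, top, K₀, hB⟩ Λ μ' ((2 * u : ℝ) / 2 ^ ℓe) ((1 / 2) ^ e₆) (1 / 8) w₁

/-- **P7 (post-processing succeeds)**: for `2n` independent units whose character law `w` is within `ε₃` of a weight `w₁`
satisfying `UnitSamplingLaw` (accuracy `δ` with `(4K₀+2) δ B² < 1`, `[ℤ^T:Λ] ≤ B`), the capped post-processor on the `2n`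
outcomes returns `[ℤ^T : Λ]` with probability at least `1 − 2n(ε₁+ε₃) − (B+1)^(log₂B+2) ((1+ε₂)²/2 + 3(ε₁+ε₃))^n`.
[cite: Hallgren2005, §4; Kitaev1995, §4] -/
def ClaimPost : Prop :=
  ∀ (P : CubicClassPost.PostParams) (Λ : AddSubgroup (Fin P.T → ℤ)) [Λ.FiniteIndex] (μ' : Fin P.T → ℝ)
    (δ ε₁ ε₂ ε₃ : ℝ) (w w₁ : ℕ → ℝ) (n : ℕ),
    1 ≤ P.T → Λ.index ≤ P.B → (4 * (P.K₀ : ℝ) + 2) * δ * (P.B : ℝ) ^ 2 < 1 → 0 ≤ δ →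
    0 ≤ ε₁ → 0 ≤ ε₂ → 0 ≤ ε₃ →
    (∀ c, 0 ≤ w c) → (∑ c ∈ Finset.range (2 ^ P.Lq), w c) = 1 →
    (∑ c ∈ Finset.range (2 ^ P.Lq), |w c - w₁ c|) ≤ ε₃ →
    UnitSamplingLaw P Λ μ' δ ε₁ ε₂ w₁ →
    1 - (2 * n * (ε₁ + ε₃) + ((P.B : ℝ) + 1) ^ (Nat.log 2 P.B + 2) * ((1 + ε₂) ^ 2 / 2 + 3 * (ε₁ + ε₃)) ^ n) ≤
      ∑ cs : Fin (2 * n) → Fin (2 ^ P.Lq),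
        if P.postOutC (List.ofFn fun u => ((cs u : ℕ))) = Λ.index then ∏ u, w (cs u) else 0

end CubicClassSampling

end Literature.Computability.Cryptography
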